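import Summits.Langlands.Langlands.Theorems.QuadraticWindowHostInducedRepPackagePolar
import Literature.NumberTheory.Automorphic.AutomorphicInductionNormTwist
import Literature.NumberTheory.Automorphic.ArthurClozelGalOrbitLift
import Literature.NumberTheory.Automorphic.AutomorphicInductionUnitaryCharacterCubicArchimedeanAssembly

/-!
# Local Asai polynomials of induced Satake parameters — helper file 1 (pure algebra) for stub
`stub_asaiPoleInduced` of line `one-transparent-pane`
(crux `Summit.Langlands.Langlands.Theses.QuadraticWindow.HostInducedRep`, item stmt-Langlands-10902)

LOG (worker `stub_asaiPoleInduced`).  This file is FACT-FREE multiset/polynomial algebra: the three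
identities between unramified Asai / Rankin–Selberg polynomials that make up the local content of
`As_{K/F₀}(Ind_{L/K} ρ) ≅ Ind_{F'/F₀} As_{L/F'}(ρ) ⊕ Ind_{F/F₀} As_{L/F}(ρ)` in a biquadratic tower
`L ⊃ K, F', F ⊃ F₀`, place by place of `F₀` (the four decomposition types are treated in the
companion file `AsaiLocalIdentity`):

* (the totally split type is the bilinearity of `det(1 - t ⊗ t' X)` in direct sums, accepted
  `satakePairPolynomial_add_left/right` of `ArthurClozelGalOrbitLift`;)
* `asaiInertPolynomial_add` — `P^η(α + β) = P^η(α) · P^η(β) · det(1 - t_α ⊗ t_β X²)` (the types where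
  the place of `K` is inert over `F₀` and split in `L`: `t_{Q,u} = t_{P,w} ⊕ t_{P,tw}`);
* `satakePairPolynomial_of_sq` — if `P_{α'}(X) = P_β(X²)` and `P_{γ'}(X) = P_δ(X²)` (`α'`, `γ'` are the
  multisets of square roots of `β`, `δ`: the induced parameters at a place of `K` inert in `L`,
  Arthur–Clozel (6.2)), then `det(1 - t_{α'} ⊗ t_{γ'} X) = det(1 - t_β ⊗ t_δ X²)²` (the type split
  in `K`, inert in `L`).

All statements are over `ℂ`; `satakePolynomial α = ∏ (X - a)`, `eulerPolynomial α = ∏ (1 - a X)`,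
`satakePairPolynomial α β = ∏ (1 - a b X)`, `asaiInertPolynomial η α = ∏ (1 - η a X) ∏_{i<j} (1 - aᵢaⱼ X²)`
are the accepted tree definitions (`SatakeParametersGL`, `AutomorphicLFunction`, `RankinSelbergLocal`,
`AsaiSign`); reused from the tree: `satakePolynomial_cons/add/pair`, `satakePairPolynomial_add_left/right`,
the roots of `P(X²)` (`eq_bind_nthRoots_of_satakePolynomial_eq_comp` of the sibling helper file
`…PackagePolar`, `roots_X_sq_sub_C_of_sq_eq`).  LANDING LOG (wave 3): de-duplicated against the
tree (the lemmas on roots of `P(X²)` and `X² - b` now come from `…PackagePolar` /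
`AutomorphicInductionUnitaryCharacterCubicArchimedeanAssembly`); registered anchor
`asaiLocalInduced_anchor` at the end.  [folklore]
-/

set_option linter.dupNamespace false -- project-wide option (lakefile weak.linter.dupNamespace); `Summit.Langlands.Langlands` is the mandated namespace

open Literature.NumberTheory.Automorphic
open Polynomial

namespace Summit.Langlands.Langlands.Theorems.HostInducedRep.OneTransparentPane

/-! ### The inert Asai polynomial of a direct sum -/

/-- `∏_{b ∈ β} (1 - a b X²)` is the Euler polynomial of `{a b}` at `X²`. [folklore] -/
theorem prod_map_one_sub_C_mul_X_sq (a : ℂ) (β : Multiset ℂ) :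
    (β.map fun b => 1 - C (a * b) * X ^ 2).prod = (eulerPolynomial (β.map (a * ·))).comp (X ^ 2) := by
  rw [eulerPolynomial_comp_X_pow, Multiset.map_map]
  rfl

/-- **The inert Asai polynomial of a direct sum**: for the block-diagonal class `t_α ⊕ t_β`,
`det(1 - As^η(t_α ⊕ t_β) T) = det(1 - As^η(t_α) T) · det(1 - As^η(t_β) T) · det(1 - t_α ⊗ t_β T²)`
(the `2`-subsets of `α + β` are those of `α`, those of `β`, and the pairs `{a, b}`).  This is the
unramified factor of `As(Ind ρ) = ⊕ …` at a place of the base inert in the middle field and split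
above. [folklore] -/
theorem asaiInertPolynomial_add (η : ℤˣ) (α β : Multiset ℂ) :
    asaiInertPolynomial η (α + β) =
      asaiInertPolynomial η α * asaiInertPolynomial η β * (satakePairPolynomial α β).comp (X ^ 2) := by
  induction α using Multiset.induction_on with
  | empty => simp [satakePairPolynomial_eq_eulerPolynomial]
  | cons a α ih =>
    rw [Multiset.cons_add, asaiInertPolynomial_cons, asaiInertPolynomial_cons, ih, Multiset.map_add,
      Multiset.prod_add, satakePairPolynomial_eq_eulerPolynomial, satakePairPolynomial_eq_eulerPolynomial,
      satakeTensor_cons_left, eulerPolynomial_add, mul_comp, prod_map_one_sub_C_mul_X_sq,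
      prod_map_one_sub_C_mul_X_sq]
    ring

/-! ### Square-root multisets (Arthur–Clozel (6.2) for `[L : K] = 2`) -/

/-- A square-root function on `ℂ`. [folklore] -/
theorem exists_sq_eq : ∃ r : ℂ → ℂ, ∀ b : ℂ, r b ^ 2 = b :=
  ⟨fun b => b ^ ((2 : ℂ)⁻¹), fun b => by
    have h := Complex.cpow_nat_inv_pow b (n := 2) two_ne_zero
    exact_mod_cast h⟩

/-- `eulerPolynomial {u, v} = (1 - u X)(1 - v X)`. [folklore] -/
theorem eulerPolynomial_pair (u v : ℂ) :
    eulerPolynomial ({u, v} : Multiset ℂ) = (1 - C u * X) * (1 - C v * X) := by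
  simp [eulerPolynomial]

/-- `{u, v}.map f = {f u, f v}`. [folklore] -/
theorem map_pair (f : ℂ → ℂ) (u v : ℂ) : ({u, v} : Multiset ℂ).map f = {f u, f v} := by
  simp

/-- `satakeTensor {u, v} γ = u γ + v γ`. [folklore] -/
theorem satakeTensor_pair_left (u v : ℂ) (γ : Multiset ℂ) :
    satakeTensor ({u, v} : Multiset ℂ) γ = γ.map (u * ·) + γ.map (v * ·) := by
  rw [Multiset.insert_eq_cons, satakeTensor_cons_left, ← Multiset.cons_zero, satakeTensor_cons_left,
    satakeTensor_zero_left, add_zero]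

/-- `∏_{d} (1 - x√d X)(1 + x√d X) = ∏_d (1 - x² d X²)`: the Euler polynomial of `x · {±√d}` is that of
`x² · δ` at `X²`. [folklore] -/
theorem eulerPolynomial_map_mul_bind_sqrt {r : ℂ → ℂ} (hr : ∀ b, r b ^ 2 = b) (x : ℂ) (δ : Multiset ℂ) :
    eulerPolynomial ((δ.bind fun d => ({r d, -r d} : Multiset ℂ)).map (x * ·)) =
      (eulerPolynomial (δ.map ((x ^ 2) * ·))).comp (X ^ 2) := by
  induction δ using Multiset.induction_on with
  | empty => simp
  | cons d δ ih =>
    rw [Multiset.cons_bind, Multiset.map_add, eulerPolynomial_add, ih, Multiset.map_cons,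
      eulerPolynomial_cons, mul_comp, sub_comp, one_comp, mul_comp, C_comp, X_comp, map_pair,
      eulerPolynomial_pair, show x ^ 2 * d = (x * r d) ^ 2 by rw [mul_pow, hr d], C_pow, C_mul, mul_neg,
      C_neg, C_mul]
    ring

/-- **Pair polynomial of two square-root multisets**:
`det(1 - t_{√β} ⊗ t_{√δ} X) = det(1 - t_β ⊗ t_δ X²)²` (each pair `(±√b, ±√d)` contributes
`(1 - √(bd) X)² (1 + √(bd) X)² = (1 - b d X²)²`). [folklore] -/
theorem satakePairPolynomial_bind_sqrt {r : ℂ → ℂ} (hr : ∀ b, r b ^ 2 = b) (β δ : Multiset ℂ) :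
    satakePairPolynomial (β.bind fun b => ({r b, -r b} : Multiset ℂ))
        (δ.bind fun d => ({r d, -r d} : Multiset ℂ)) =
      ((satakePairPolynomial β δ).comp (X ^ 2)) ^ 2 := by
  induction β using Multiset.induction_on with
  | empty => simp [satakePairPolynomial_eq_eulerPolynomial]
  | cons b β ih =>
    rw [Multiset.cons_bind, satakePairPolynomial_add_left, ih, satakePairPolynomial_eq_eulerPolynomial,
      satakePairPolynomial_eq_eulerPolynomial, satakePairPolynomial_eq_eulerPolynomial,
      satakeTensor_cons_left, eulerPolynomial_add, mul_comp, mul_pow, satakeTensor_pair_left,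
      eulerPolynomial_add, eulerPolynomial_map_mul_bind_sqrt hr, eulerPolynomial_map_mul_bind_sqrt hr,
      neg_sq, hr b]
    ring

/-- **The type "split in `K`, inert in `L`"** (Arthur–Clozel (6.2), `l = 2`): if `P_{α'}(X) = P_β(X²)`
and `P_{γ'}(X) = P_δ(X²)` — `α'`, `γ'` are the Satake parameters induced through an inert quadratic
place from `β`, `δ` — then `det(1 - t_{α'} ⊗ t_{γ'} X) = det(1 - t_β ⊗ t_δ X²)²`. [folklore] -/
theorem satakePairPolynomial_of_sq {α' β γ' δ : Multiset ℂ}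
    (hα : satakePolynomial α' = (satakePolynomial β).comp (X ^ 2))
    (hγ : satakePolynomial γ' = (satakePolynomial δ).comp (X ^ 2)) :
    satakePairPolynomial α' γ' = ((satakePairPolynomial β δ).comp (X ^ 2)) ^ 2 := by
  obtain ⟨r, hr⟩ := exists_sq_eq
  -- the multiset of square roots (`…PackagePolar`: roots of `P(X²)` are the `nthRoots 2`)
  have hroots : ∀ μ : Multiset ℂ,
      μ.bind (Polynomial.nthRoots 2) = μ.bind fun b => ({r b, -r b} : Multiset ℂ) :=
    fun μ => Multiset.bind_congr fun b _ => by
      rw [Polynomial.nthRoots, roots_X_sq_sub_C_of_sq_eq (hr b)]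
  rw [eq_bind_nthRoots_of_satakePolynomial_eq_comp two_pos hα,
    eq_bind_nthRoots_of_satakePolynomial_eq_comp two_pos hγ, hroots, hroots,
    satakePairPolynomial_bind_sqrt hr]

/-! ### Evaluated forms (`X = q_v^{-s}`, `X² = q_v^{-2s} = (q_v²)^{-s}`) -/

/-- `(p.comp (X^2)).eval x = p.eval (x^2)`. [folklore] -/
theorem eval_comp_X_sq (p : ℂ[X]) (x : ℂ) : (p.comp (X ^ 2)).eval x = p.eval (x ^ 2) := by
  rw [eval_comp, eval_pow, eval_X]

/-- `(q²)^{-s} = (q^{-s})²` for a natural number `q`. [folklore] -/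
theorem natCast_sq_cpow_neg (q : ℕ) (s : ℂ) :
    (((q ^ 2 : ℕ) : ℂ)) ^ (-s) = (((q : ℂ)) ^ (-s)) ^ 2 := by
  rw [Nat.cast_pow, ← Complex.natCast_cpow_natCast_mul, Complex.cpow_nat_mul]

/-- **Registered anchor** of this helper file (stub registry of stmt-Langlands-10902, line
`one-transparent-pane`, chain `stub_asaiPoleInduced` 1/7): the inert Asai polynomial of a direct sum,
`asaiInertPolynomial_add`. [folklore] -/
theorem asaiLocalInduced_anchor : ∀ (η : ℤˣ) (α β : Multiset ℂ), asaiInertPolynomial η (α + β) = asaiInertPolynomial η α * asaiInertPolynomial η β * (satakePairPolynomial α β).comp (X ^ 2) :=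
  asaiInertPolynomial_add

end Summit.Langlands.Langlands.Theorems.HostInducedRep.OneTransparentPane
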